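import Mathlib
import Summits.Ventures.DiscreteObjects.Mahler.CensusKernelDeg26P089
import Summits.Ventures.DiscreteObjects.Mahler.CensusKernelDeg26P090
import Summits.Ventures.DiscreteObjects.Mahler.CensusKernelDeg26P088
import Summits.Ventures.DiscreteObjects.Mahler.CensusKernelDeg26P091
import Summits.Ventures.DiscreteObjects.Mahler.CensusKernelDeg26P093
import Summits.Ventures.DiscreteObjects.Mahler.CensusKernelDeg26P094
import Summits.Ventures.DiscreteObjects.Mahler.CensusKernelDeg26P092
import Summits.Ventures.DiscreteObjects.Mahler.CensusKernelDeg26P095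
import Summits.Ventures.DiscreteObjects.Mahler.CensusKernelDeg26P097
import Summits.Ventures.DiscreteObjects.Mahler.CensusKernelDeg26P098
import Summits.Ventures.DiscreteObjects.Mahler.CensusKernelDeg26P096
import Summits.Ventures.DiscreteObjects.Mahler.CensusKernelDeg26P099

/-!
# Kernel census, degree 26 at `B = 20/17` (part S05): node lemmas of the subtree `[0,2]` — the nodes whose kernel checks span several parts

Cell `pub-namedobj`, seats `pub-namedobj-mahler-g19`/`g20`/`g21` (pipeline of seats g12–g18). Framing: lottery ticket; floor = certified bounds/negative ranges.

Part of the kernel proof of `DegreeCensus 26 (20/17) coresDeg26` (tables in part Tables; validity in part A: census search with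
kernel-certified explicit-auxiliary-function cuts and certified leaf thresholds at `B = 20/17`; 4626568 leaves with `c_1 >= 0`,
120525 small-cyclotomic survivors dropped in the kernel, 39903 survivors certified by extended certificates `CertX`: base red/cyc/exc
or trace-Graeffe `tgr`).  This part re-assembles, by `interval_cases` on `c₃`, the node lemmas of the nodes `(c₁, c₂)` whose per-`c₃` kernel checks live in the
chunk parts (it imports all of them).
CONTROL/replication (Lehmer's bound at degree 26; print complete to degree 44), not new ground.
This file imports the 12 census parts whose node lemmas it combines DIRECTLY (mahler g21 re-packaging of g19's
collector/NL chain: one build-lane round trip instead of sixteen; lemma texts unchanged).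
-/

namespace Summit.Ventures.DiscreteObjects.Mahler

open Polynomial

/-- Every survivor below the node `[0, 2, -1, 2]` carries a valid certificate (by cases on the next coefficient). -/
theorem certified26n_p0_p2_m1_p2 : ∀ a ∈ censusSearchC T26 CT26 9 [0, 2, -1, 2] (psumsRev [0, 2, -1, 2] 4),
    ∃ c, checkCertX 20 17 13 coresDeg26 LC26 (1 :: palC a) c = true := by
  intro a ha
  rw [mem_censusSearchC_node_iff (pre := [0, 2, -1, 2]) (n := 4) rfl, (by decide +kernel : nodeLoC T26 CT26 [0, 2, -1, 2] (psumsRev [0, 2, -1, 2] 4) = -3), (by decide +kernel : nodeHiC T26 CT26 [0, 2, -1, 2] (psumsRev [0, 2, -1, 2] 4) = -1)] at ha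
  obtain ⟨ak, hak, ha⟩ := ha
  simp only [List.cons_append, List.nil_append, Nat.reduceAdd] at ha
  rw [mem_icc] at hak
  obtain ⟨hlo, hhi⟩ := hak
  interval_cases ak
  · exact certified26n_p0_p2_m1_p2_m3 a ha
  · exact certified26n_p0_p2_m1_p2_m2 a ha
  · exact certified26n_p0_p2_m1_p2_m1 a ha

/-- Every survivor below the node `[0, 2, -1]` carries a valid certificate (by cases on the next coefficient). -/
theorem certified26n_p0_p2_m1 : ∀ a ∈ censusSearchC T26 CT26 10 [0, 2, -1] (psumsRev [0, 2, -1] 3),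
    ∃ c, checkCertX 20 17 13 coresDeg26 LC26 (1 :: palC a) c = true := by
  intro a ha
  rw [mem_censusSearchC_node_iff (pre := [0, 2, -1]) (n := 3) rfl, (by decide +kernel : nodeLoC T26 CT26 [0, 2, -1] (psumsRev [0, 2, -1] 3) = 1), (by decide +kernel : nodeHiC T26 CT26 [0, 2, -1] (psumsRev [0, 2, -1] 3) = 3)] at ha
  obtain ⟨ak, hak, ha⟩ := ha
  simp only [List.cons_append, List.nil_append, Nat.reduceAdd] at ha
  rw [mem_icc] at hak
  obtain ⟨hlo, hhi⟩ := hak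
  interval_cases ak
  · exact certified26n_p0_p2_m1_p1 a ha
  · exact certified26n_p0_p2_m1_p2 a ha
  · exact certified26n_p0_p2_m1_p3 a ha

/-- Every survivor below the node `[0, 2, 0, 2]` carries a valid certificate (by cases on the next coefficient). -/
theorem certified26n_p0_p2_p0_p2 : ∀ a ∈ censusSearchC T26 CT26 9 [0, 2, 0, 2] (psumsRev [0, 2, 0, 2] 4),
    ∃ c, checkCertX 20 17 13 coresDeg26 LC26 (1 :: palC a) c = true := by
  intro a ha
  rw [mem_censusSearchC_node_iff (pre := [0, 2, 0, 2]) (n := 4) rfl, (by decide +kernel : nodeLoC T26 CT26 [0, 2, 0, 2] (psumsRev [0, 2, 0, 2] 4) = -1), (by decide +kernel : nodeHiC T26 CT26 [0, 2, 0, 2] (psumsRev [0, 2, 0, 2] 4) = 1)] at ha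
  obtain ⟨ak, hak, ha⟩ := ha
  simp only [List.cons_append, List.nil_append, Nat.reduceAdd] at ha
  rw [mem_icc] at hak
  obtain ⟨hlo, hhi⟩ := hak
  interval_cases ak
  · exact certified26n_p0_p2_p0_p2_m1 a ha
  · exact certified26n_p0_p2_p0_p2_p0 a ha
  · exact certified26n_p0_p2_p0_p2_p1 a ha

/-- Every survivor below the node `[0, 2, 0]` carries a valid certificate (by cases on the next coefficient). -/
theorem certified26n_p0_p2_p0 : ∀ a ∈ censusSearchC T26 CT26 10 [0, 2, 0] (psumsRev [0, 2, 0] 3),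
    ∃ c, checkCertX 20 17 13 coresDeg26 LC26 (1 :: palC a) c = true := by
  intro a ha
  rw [mem_censusSearchC_node_iff (pre := [0, 2, 0]) (n := 3) rfl, (by decide +kernel : nodeLoC T26 CT26 [0, 2, 0] (psumsRev [0, 2, 0] 3) = 1), (by decide +kernel : nodeHiC T26 CT26 [0, 2, 0] (psumsRev [0, 2, 0] 3) = 3)] at ha
  obtain ⟨ak, hak, ha⟩ := ha
  simp only [List.cons_append, List.nil_append, Nat.reduceAdd] at ha
  rw [mem_icc] at hak
  obtain ⟨hlo, hhi⟩ := hak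
  interval_cases ak
  · exact certified26n_p0_p2_p0_p1 a ha
  · exact certified26n_p0_p2_p0_p2 a ha
  · exact certified26n_p0_p2_p0_p3 a ha

/-- Every survivor below the node `[0, 2, 1, 2]` carries a valid certificate (by cases on the next coefficient). -/
theorem certified26n_p0_p2_p1_p2 : ∀ a ∈ censusSearchC T26 CT26 9 [0, 2, 1, 2] (psumsRev [0, 2, 1, 2] 4),
    ∃ c, checkCertX 20 17 13 coresDeg26 LC26 (1 :: palC a) c = true := by
  intro a ha
  rw [mem_censusSearchC_node_iff (pre := [0, 2, 1, 2]) (n := 4) rfl, (by decide +kernel : nodeLoC T26 CT26 [0, 2, 1, 2] (psumsRev [0, 2, 1, 2] 4) = 1), (by decide +kernel : nodeHiC T26 CT26 [0, 2, 1, 2] (psumsRev [0, 2, 1, 2] 4) = 3)] at ha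
  obtain ⟨ak, hak, ha⟩ := ha
  simp only [List.cons_append, List.nil_append, Nat.reduceAdd] at ha
  rw [mem_icc] at hak
  obtain ⟨hlo, hhi⟩ := hak
  interval_cases ak
  · exact certified26n_p0_p2_p1_p2_p1 a ha
  · exact certified26n_p0_p2_p1_p2_p2 a ha
  · exact certified26n_p0_p2_p1_p2_p3 a ha

/-- Every survivor below the node `[0, 2, 1]` carries a valid certificate (by cases on the next coefficient). -/
theorem certified26n_p0_p2_p1 : ∀ a ∈ censusSearchC T26 CT26 10 [0, 2, 1] (psumsRev [0, 2, 1] 3),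
    ∃ c, checkCertX 20 17 13 coresDeg26 LC26 (1 :: palC a) c = true := by
  intro a ha
  rw [mem_censusSearchC_node_iff (pre := [0, 2, 1]) (n := 3) rfl, (by decide +kernel : nodeLoC T26 CT26 [0, 2, 1] (psumsRev [0, 2, 1] 3) = 1), (by decide +kernel : nodeHiC T26 CT26 [0, 2, 1] (psumsRev [0, 2, 1] 3) = 3)] at ha
  obtain ⟨ak, hak, ha⟩ := ha
  simp only [List.cons_append, List.nil_append, Nat.reduceAdd] at ha
  rw [mem_icc] at hak
  obtain ⟨hlo, hhi⟩ := hak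
  interval_cases ak
  · exact certified26n_p0_p2_p1_p1 a ha
  · exact certified26n_p0_p2_p1_p2 a ha
  · exact certified26n_p0_p2_p1_p3 a ha

/-- Every survivor below the node `[0, 2]` carries a valid certificate (by cases on the next coefficient). -/
theorem certified26n_p0_p2 : ∀ a ∈ censusSearchC T26 CT26 11 [0, 2] (psumsRev [0, 2] 2),
    ∃ c, checkCertX 20 17 13 coresDeg26 LC26 (1 :: palC a) c = true := by
  intro a ha
  rw [mem_censusSearchC_node_iff (pre := [0, 2]) (n := 2) rfl, (by decide +kernel : nodeLoC T26 CT26 [0, 2] (psumsRev [0, 2] 2) = -1), (by decide +kernel : nodeHiC T26 CT26 [0, 2] (psumsRev [0, 2] 2) = 1)] at ha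
  obtain ⟨ak, hak, ha⟩ := ha
  simp only [List.cons_append, List.nil_append, Nat.reduceAdd] at ha
  rw [mem_icc] at hak
  obtain ⟨hlo, hhi⟩ := hak
  interval_cases ak
  · exact certified26n_p0_p2_m1 a ha
  · exact certified26n_p0_p2_p0 a ha
  · exact certified26n_p0_p2_p1 a ha

end Summit.Ventures.DiscreteObjects.Mahler
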